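import Summits.QuantumFields.YangMills.Theorems.BalabanLadderUVSeamRecClassicalResponseGlue
import Summits.QuantumFields.YangMills.Theorems.BalabanLadderUVSeamRecPolymerCarrierLevels
import HarnessLib

/-!
# Crux `UVSeamRec` (stmt-QuantumFields-20043): where the tempering data of «background field» (BF) carry content —
# the influence functional under TRIVIAL temperings, and (BF) from the tempering-free classical split

Helper file (`--supports stmt-QuantumFields-20043`) of the unit `ym-20043-tempered-d1` (gen 2), in the currency of its own D1 files
(p531519 `…PolymerData`, p533172 `…PolymerInfluence`, p545222 `…PolymerCarrierLevels`) and of the LEAD's v6(β-cl) glue p548409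
(`ClassicalResponse.SplitCl` / `EMI` / `BackgroundFieldSU2` / `GaussianDominationSU2`).

WHAT IS PROVED (bookkeeping, no renormalisation-group content):
* §1 ORDER STRUCTURE of the influence functional `I = Σ_{γ ∈ shell} c_γ·1_{E_γ}` in its tempering data: antitone in the thresholds
  `ε` (larger thresholds flag fewer polymers), monotone in the level cutoff `kmax`; `I ≡ 0` at thresholds `> 2` (every large-field event
  is empty, p531519 `largeFieldEvent_eq_empty_of_two_lt`); two measurability-light torus-expectation tools.
* §2 THE TWO CONJUNCTS OF (BF) PULL IN OPPOSITE DIRECTIONS: (split-cl) is MONOTONE in the flags (`splitCl_mono`), (EM_I) is ANTITONE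
  (`emi_anti`) — the typed form of «the thresholds must be small enough for the expansion and large enough for rarity».
* §3 (EM_I) WITHOUT PROBABILITY: `emi_of_forall_le` (a sure bound `I ≤ M` gives (EM_I) with `B_I = 2M`), hence `emi_of_two_lt`
  (thresholds `> 2`: `B_I = 0`) and `emi_of_kmax_le` (ANY thresholds, level cutoff `≤ k₀`: `B_I = 2·1536·(k₀+1)`, from p545222
  `abs_influenceAt_le_levels`).  So the (EM_I) conjunct of (BF) is discharged for free at every BOUNDED level count; it constrains the
  prover of (BF) only when `kmax β R` is unbounded along the guard `1 ≤ R`, `R·uRec β ≤ ℓ₁` (v5's `Nat.log b (R+1) ≤ kmax β R + k₀`).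
* §4 THE TEMPERING-FREE CLASSICAL SPLIT `PureSplitClSU2` («`(R⁴/C₁)|kerE(plane)(η) − p| ≤ A₀ + carrierCl C_s 1 β R q x η` for EVERY
  exterior», no large-field term) IMPLIES `BackgroundFieldSU2` (`backgroundFieldSU2_of_pureSplitCl`: temper trivially, `ε ≡ 3`,
  `B_I = 0`), and is EQUIVALENT to (BF) restricted to bounded level cutoffs (`backgroundFieldBoundedSU2_iff`); with (GD) it gives the
  registered v5(α) stub body by the LEAD's glue (`responseMomentsOdd6SU2_of_pureSplitCl_and_gaussianDomination`).

HONEST READING (for the owner's «v6 only if it buys a closable piece»): in the classical-response currency the large-field half of (BF) is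
a PROOF DEVICE offered to the prover of (split-cl) — it lets him excuse exteriors with large block fields near the cube at the price of
their joint rarity — not separately closable content: (EM_I) alone is free (§3), and (BF) is implied by the flag-free split (§4).  The
renormalisation-group content of (BF) is (split-cl) RELATIVE TO the chosen flags; (EM_I) bites exactly when the cutoff grows with `R`,
where the unit's g0 OBJECTION-top-scale (evidence #41 on the item) applies to the top `O(log log R)` levels.  Nothing here asserts
(split-cl), (EM_I) at growing cutoff, (GD) or anything of E0′; not a gap claim, not Clay.
-/

set_option autoImplicit false

noncomputable section

open MeasureTheory Filter Topology Finset
open Literature.MathematicalPhysics.QuantumFieldTheory (GaugeConfig LatticeRep wilsonMeasure isProbabilityMeasure_wilsonMeasure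
  measurable_torusLift)
open Literature.MathematicalPhysics.QuantumLattice
open Summit.QuantumFields.YangMills.Cruxes.OSLegsFromFemtoAndGap.DlrCollarTransfer
open Summit.QuantumFields.YangMills.Cruxes.UVSeamRec.ClassicalResponse
open Summit.QuantumFields.YangMills.Cruxes.UVSeamRec.PolymerData
open Summit.QuantumFields.YangMills.Cruxes.UVSeamRec.TemperedResponse

/-! ## §0 Two torus-expectation tools that do not ask for continuity -/

namespace Summit.QuantumFields.YangMills.Cruxes.UVSeamRec.PolymerData

section Toolkit

variable {G : Type} [Group G] [TopologicalSpace G] [IsTopologicalGroup G] [CompactSpace G]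
  [MeasurableSpace G] [BorelSpace G] (r : LatticeRep G)

/-- A SURE bound passes to the torus expectation: `0 ≤ F ≤ c` everywhere ⇒ `⟨F∘lift⟩_{2L+1,β} ≤ c` (no measurability of `F` is
needed: a non-integrable `F` has Bochner integral `0 ≤ c`). [folklore] -/
theorem torusE_le_of_forall_le (β : ℝ) (L : ℕ) {F : LGConfig 4 G → ℝ} {c : ℝ}
    (h0 : ∀ η, 0 ≤ F η) (hle : ∀ η, F η ≤ c) : torusE G r β L F ≤ c := by
  haveI := isProbabilityMeasure_wilsonMeasure (d := 4) (L := 2 * L + 1) r.ρ r.continuous β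
  unfold torusE
  calc ∫ U, F (torusLift (2 * L + 1) U) ∂(wilsonMeasure (d := 4) (L := 2 * L + 1) r.ρ β)
      ≤ ∫ _U, c ∂(wilsonMeasure (d := 4) (L := 2 * L + 1) r.ρ β) :=
        integral_mono_of_nonneg (ae_of_all _ fun U => h0 _) (integrable_const c) (ae_of_all _ fun U => hle _)
    _ = c := by rw [integral_const, smul_eq_mul, probReal_univ, one_mul]

/-- Monotonicity of the torus expectation for a nonnegative observable dominated by a BOUNDED MEASURABLE one. [folklore] -/
theorem torusE_mono_of_measurable (β : ℝ) (L : ℕ) {A B : LGConfig 4 G → ℝ} {c : ℝ}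
    (hA : ∀ η, 0 ≤ A η) (hBm : Measurable B) (hBb : ∀ η, |B η| ≤ c) (hle : ∀ η, A η ≤ B η) :
    torusE G r β L A ≤ torusE G r β L B := by
  haveI := isProbabilityMeasure_wilsonMeasure (d := 4) (L := 2 * L + 1) r.ρ r.continuous β
  unfold torusE
  exact integral_mono_of_nonneg (ae_of_all _ fun U => hA _)
    (integrable_of_abs_le (hBm.comp (measurable_torusLift _)) fun U => hBb _) (ae_of_all _ fun U => hle _)

end Toolkit

/-! ## §1 The influence functional in its tempering data: antitone in the thresholds, monotone in the cutoff, zero above `2` -/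

section Order

variable {N : ℕ} [NeZero N]

/-- Large-field events are ANTITONE in the threshold: `ε ≤ ε'` ⇒ `E_γ(ε') ⊆ E_γ(ε)`. -/
theorem largeFieldEvent_anti (𝔟 : BlockSize) {ε ε' : ℝ} (h : ε ≤ ε') (γ : Polymer) :
    largeFieldEvent (N := N) 𝔟 ε' γ ⊆ largeFieldEvent (N := N) 𝔟 ε γ :=
  fun _ hη => h.trans hη

/-- The shell is MONOTONE in the level cutoff. -/
theorem shell_mono (𝔟 : BlockSize) {kmax kmax' : ℕ} (h : kmax ≤ kmax') (R : ℕ) (x : Fin 4 → ℤ) :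
    shell 𝔟 kmax R x ⊆ shell 𝔟 kmax' R x := fun γ hγ => by
  rw [mem_shell_iff] at hγ ⊢
  exact ⟨hγ.1.trans h, hγ.2⟩

/-- **The influence functional is monotone in the flags**: lowering the thresholds (`ε' ≤ ε` levelwise) and raising the cutoff
(`kmax ≤ kmax'`) can only increase `I`. -/
theorem influence_mono (𝔟 : BlockSize) {ε ε' : ℕ → ℝ} (hε : ∀ k, ε' k ≤ ε k) {kmax kmax' : ℕ} (hk : kmax ≤ kmax')
    (R : ℕ) (x : Fin 4 → ℤ) (η : LGConfig 4 (Matrix.specialUnitaryGroup (Fin N) ℂ)) :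
    influence (N := N) 𝔟 ε kmax R x η ≤ influence (N := N) 𝔟 ε' kmax' R x η := by
  unfold influence
  calc ∑ γ ∈ shell 𝔟 kmax R x, influenceCoeff 𝔟 γ x * (largeFieldEvent (N := N) 𝔟 (ε γ.k) γ).indicator (fun _ => (1 : ℝ)) η
      ≤ ∑ γ ∈ shell 𝔟 kmax R x, influenceCoeff 𝔟 γ x * (largeFieldEvent (N := N) 𝔟 (ε' γ.k) γ).indicator (fun _ => (1 : ℝ)) η :=
        Finset.sum_le_sum fun γ _ => mul_le_mul_of_nonneg_left
          (Set.indicator_le_indicator_of_subset (largeFieldEvent_anti (N := N) 𝔟 (hε γ.k) γ) (fun _ => zero_le_one) η)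
          (influenceCoeff_nonneg 𝔟 γ x)
    _ ≤ ∑ γ ∈ shell 𝔟 kmax' R x, influenceCoeff 𝔟 γ x * (largeFieldEvent (N := N) 𝔟 (ε' γ.k) γ).indicator (fun _ => (1 : ℝ)) η :=
        Finset.sum_le_sum_of_subset_of_nonneg (shell_mono 𝔟 hk R x) fun γ _ _ =>
          mul_nonneg (influenceCoeff_nonneg 𝔟 γ x) (Set.indicator_nonneg (fun _ _ => zero_le_one) _)

/-- **At thresholds `> 2` the influence functional vanishes identically** (every large-field event is empty: `1 − reTr ≤ 2`). -/
theorem influence_eq_zero_of_two_lt (𝔟 : BlockSize) {ε : ℕ → ℝ} (hε : ∀ k, 2 < ε k) (kmax R : ℕ) (x : Fin 4 → ℤ)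
    (η : LGConfig 4 (Matrix.specialUnitaryGroup (Fin N) ℂ)) : influence (N := N) 𝔟 ε kmax R x η = 0 := by
  unfold influence
  refine Finset.sum_eq_zero fun γ _ => ?_
  rw [largeFieldEvent_eq_empty_of_two_lt (N := N) 𝔟 (hε γ.k) γ, Set.indicator_empty, mul_zero]

/-- `influenceAt` is monotone in the flags (thresholds down, cutoff up), pointwise in `(β, R)`. -/
theorem influenceAt_mono (𝔟 : BlockSize) {ε ε' : ℝ → ℕ → ℝ} (hε : ∀ β k, ε' β k ≤ ε β k) {kmax kmax' : ℝ → ℕ → ℕ}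
    (hk : ∀ β R, kmax β R ≤ kmax' β R) (β : ℝ) (R : ℕ) (q : Fin 4 × Fin 4) (x : Fin 4 → ℤ)
    (η : LGConfig 4 (Matrix.specialUnitaryGroup (Fin N) ℂ)) :
    influenceAt (N := N) 𝔟 ε kmax β R q x η ≤ influenceAt (N := N) 𝔟 ε' kmax' β R q x η := by
  rw [influenceAt_eq, influenceAt_eq]
  exact influence_mono (N := N) 𝔟 (hε β) (hk β R) R x η

/-- `influenceAt ≡ 0` at thresholds `> 2`. -/
theorem influenceAt_eq_zero_of_two_lt (𝔟 : BlockSize) {ε : ℝ → ℕ → ℝ} (hε : ∀ β k, 2 < ε β k) (kmax : ℝ → ℕ → ℕ) (β : ℝ)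
    (R : ℕ) (q : Fin 4 × Fin 4) (x : Fin 4 → ℤ) (η : LGConfig 4 (Matrix.specialUnitaryGroup (Fin N) ℂ)) :
    influenceAt (N := N) 𝔟 ε kmax β R q x η = 0 := by
  rw [influenceAt_eq]
  exact influence_eq_zero_of_two_lt (N := N) 𝔟 (hε β) (kmax β R) R x η

/-- `0 ≤ influenceAt`. -/
theorem influenceAt_nonneg (𝔟 : BlockSize) (ε : ℝ → ℕ → ℝ) (kmax : ℝ → ℕ → ℕ) (β : ℝ) (R : ℕ) (q : Fin 4 × Fin 4)
    (x : Fin 4 → ℤ) (η : LGConfig 4 (Matrix.specialUnitaryGroup (Fin N) ℂ)) : 0 ≤ influenceAt (N := N) 𝔟 ε kmax β R q x η := by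
  rw [influenceAt_eq]
  exact influence_nonneg (N := N) 𝔟 (ε β) (kmax β R) R x η

/-- `influenceAt ≤ 1536·(k₀+1)` whenever the level cutoff is `≤ k₀`. -/
theorem influenceAt_le_of_kmax_le (𝔟 : BlockSize) (ε : ℝ → ℕ → ℝ) {kmax : ℝ → ℕ → ℕ} {k₀ : ℕ} (hk : ∀ β R, kmax β R ≤ k₀)
    (β : ℝ) (R : ℕ) (q : Fin 4 × Fin 4) (x : Fin 4 → ℤ) (η : LGConfig 4 (Matrix.specialUnitaryGroup (Fin N) ℂ)) :
    influenceAt (N := N) 𝔟 ε kmax β R q x η ≤ 1536 * ((k₀ : ℝ) + 1) := by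
  refine ((le_abs_self _).trans (abs_influenceAt_le_levels (N := N) 𝔟 ε kmax β R q x η)).trans ?_
  have : (kmax β R : ℝ) ≤ k₀ := by exact_mod_cast hk β R
  nlinarith

end Order

end Summit.QuantumFields.YangMills.Cruxes.UVSeamRec.PolymerData

namespace Summit.QuantumFields.YangMills.Cruxes.UVSeamRec.ClassicalResponse

/-! ## §2 The two conjuncts of (BF) pull in opposite directions -/

section Opposite

/-- **(split-cl) is MONOTONE in the flags**: more flags (thresholds down, cutoff up) make (split-cl) weaker, hence easier. [folklore] -/
theorem splitCl_mono {𝔟 : BlockSize} {ε ε' : ℝ → ℕ → ℝ} (hε : ∀ β k, ε' β k ≤ ε β k) {kmax kmax' : ℝ → ℕ → ℕ}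
    (hk : ∀ β R, kmax β R ≤ kmax' β R) {C C₁ A₀ β₁ ℓ₁ : ℝ} {p : Fin 4 × Fin 4 → ℝ → ℝ}
    (h : SplitCl 𝔟 ε kmax C C₁ A₀ β₁ ℓ₁ p) : SplitCl 𝔟 ε' kmax' C C₁ A₀ β₁ ℓ₁ p :=
  fun β hβ R hR hRa q x hq η =>
    (h β hβ R hR hRa q x hq η).trans (by linarith [influenceAt_mono (N := 2) 𝔟 hε hk β R q x η])

/-- **(EM_I) is ANTITONE in the flags**: more flags make the joint exponential moments larger, hence (EM_I) harder; equivalently (EM_I)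
for a richer tempering implies (EM_I) for a poorer one with the same constant. [folklore] -/
theorem emi_anti {𝔟 : BlockSize} {ε ε' : ℝ → ℕ → ℝ} (hε : ∀ β k, ε' β k ≤ ε β k) {kmax kmax' : ℝ → ℕ → ℕ}
    (hk : ∀ β R, kmax β R ≤ kmax' β R) {β₁ ℓ₁ B_I : ℝ}
    (h : EMI 𝔟 ε' kmax' β₁ ℓ₁ B_I) : EMI 𝔟 ε kmax β₁ ℓ₁ B_I := by
  intro β hβ L n q x R hq hR hRa hL hsep T
  refine le_trans ?_ (h β hβ L n q x R hq hR hRa hL hsep T)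
  refine torusE_mono_of_measurable (fundamentalLatticeRep 2) β L (fun η => (Real.exp_pos _).le)
    (((Finset.measurable_sum T fun i _ => measurable_influenceAt (N := 2) 𝔟 ε' kmax' β R (q i) (x i)).const_mul _).exp)
    (c := Real.exp (((2 : ℕ) : ℝ) * ∑ i ∈ T, (1536 : ℝ) * ((kmax' β R : ℝ) + 1))) (fun η => ?_) (fun η => ?_)
  · rw [Real.abs_exp]
    refine Real.exp_le_exp.2 (mul_le_mul_of_nonneg_left (Finset.sum_le_sum fun i _ => ?_) (by positivity))
    exact (le_abs_self _).trans (abs_influenceAt_le_levels (N := 2) 𝔟 ε' kmax' β R (q i) (x i) η)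
  · exact Real.exp_le_exp.2 (mul_le_mul_of_nonneg_left
      (Finset.sum_le_sum fun i _ => influenceAt_mono (N := 2) 𝔟 hε hk β R (q i) (x i) η) (by positivity))

end Opposite

/-! ## §3 (EM_I) without probability: sure bounds on the influence functional -/

section Sure

/-- **(EM_I) FROM A SURE BOUND**: if `influenceAt ≤ M` identically then (EM_I) holds with `B_I = 2M` (the integrand is `≤ exp(2M·#T)`
surely). [folklore] -/
theorem emi_of_forall_le {𝔟 : BlockSize} {ε : ℝ → ℕ → ℝ} {kmax : ℝ → ℕ → ℕ} {M : ℝ}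
    (hM : ∀ (β : ℝ) (R : ℕ) (q : Fin 4 × Fin 4) (x : Fin 4 → ℤ) (η : LGConfig 4 (Matrix.specialUnitaryGroup (Fin 2) ℂ)),
      influenceAt (N := 2) 𝔟 ε kmax β R q x η ≤ M) (β₁ ℓ₁ : ℝ) :
    EMI 𝔟 ε kmax β₁ ℓ₁ (2 * M) := by
  intro β _ L n q x R _ _ _ _ _ T
  refine torusE_le_of_forall_le (fundamentalLatticeRep 2) β L (fun η => (Real.exp_pos _).le) fun η => ?_
  refine Real.exp_le_exp.2 ?_
  calc ((2 : ℕ) : ℝ) * ∑ i ∈ T, influenceAt (N := 2) 𝔟 ε kmax β R (q i) (x i) η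
      ≤ ((2 : ℕ) : ℝ) * ∑ _i ∈ T, M :=
        mul_le_mul_of_nonneg_left (Finset.sum_le_sum fun i _ => hM β R (q i) (x i) η) (by positivity)
    _ = 2 * M * T.card := by rw [Finset.sum_const, nsmul_eq_mul]; push_cast; ring

/-- **(EM_I) AT THRESHOLDS `> 2` WITH `B_I = 0`**: no polymer is ever flagged, the influence functional is `≡ 0`. [folklore] -/
theorem emi_of_two_lt (𝔟 : BlockSize) {ε : ℝ → ℕ → ℝ} (hε : ∀ β k, 2 < ε β k) (kmax : ℝ → ℕ → ℕ) (β₁ ℓ₁ : ℝ) :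
    EMI 𝔟 ε kmax β₁ ℓ₁ 0 := by
  have h := emi_of_forall_le (𝔟 := 𝔟) (ε := ε) (kmax := kmax) (M := 0)
    (fun β R q x η => (influenceAt_eq_zero_of_two_lt (N := 2) 𝔟 hε kmax β R q x η).le) β₁ ℓ₁
  rwa [mul_zero] at h

/-- **(EM_I) AT EVERY BOUNDED LEVEL CUTOFF, FOR ANY THRESHOLDS, WITH `B_I = 2·1536·(k₀+1)`** — the sure bound of p545222
`abs_influenceAt_le_levels`; no Peierls estimate, no product law, uniform in `β`, `R`, `L`. [folklore] -/
theorem emi_of_kmax_le (𝔟 : BlockSize) (ε : ℝ → ℕ → ℝ) {kmax : ℝ → ℕ → ℕ} {k₀ : ℕ} (hk : ∀ β R, kmax β R ≤ k₀) (β₁ ℓ₁ : ℝ) :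
    EMI 𝔟 ε kmax β₁ ℓ₁ (2 * (1536 * ((k₀ : ℝ) + 1))) :=
  emi_of_forall_le (fun β R q x η => influenceAt_le_of_kmax_le (N := 2) 𝔟 ε hk β R q x η) β₁ ℓ₁

end Sure

/-! ## §4 The tempering-free classical split and (BF) -/

section Pure

/-- (split-cl) WITHOUT a large-field term, at carrier constant `C`, kernel constant `C₁`: for EVERY exterior,
`(R⁴/C₁)|kerE(plane q x)(η) − p q β| ≤ A₀ + carrierCl rF C 1 β R q x η` on the guard `β ≥ β₁`, `1 ≤ R`, `R·uRec β ≤ ℓ₁`. -/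
def PureSplitCl (C C₁ A₀ β₁ ℓ₁ : ℝ) (p : Fin 4 × Fin 4 → ℝ → ℝ) : Prop :=
  ∀ β : ℝ, β₁ ≤ β → ∀ R : ℕ, 1 ≤ R → (R : ℝ) * Transport.uRec β ≤ ℓ₁ →
    ∀ (q : Fin 4 × Fin 4) (x : Fin 4 → ℤ), q.1 < q.2 → ∀ η : LGConfig 4 (Matrix.specialUnitaryGroup (Fin 2) ℂ),
      (R : ℝ) ^ 4 / C₁ * |kerE (Matrix.specialUnitaryGroup (Fin 2) ℂ) (fundamentalLatticeRep 2) β (fun k => x k - (R + 1)) (2 * R + 3) η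
        (plane (Matrix.specialUnitaryGroup (Fin 2) ℂ) (fundamentalLatticeRep 2) q x) - p q β| ≤
        A₀ + carrierCl (fundamentalLatticeRep 2) C 1 β R q x η

/-- **THE TEMPERING-FREE CLASSICAL SPLIT at `SU(2)`** («quantum response ≤ A₀ + β × classical response, for every exterior»): the
would-be `stub_backgroundField` of v6(β-cl) with the large-field machinery switched off.  OPEN (E0′-K with the classical minimiser as
background and NO large-field excuse). -/
def PureSplitClSU2 : Prop :=
  ∃ (C_s C₁ A₀ P₀ β₁ ℓ₁ : ℝ) (p : Fin 4 × Fin 4 → ℝ → ℝ),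
    0 < C_s ∧ 0 < C₁ ∧ 0 ≤ A₀ ∧ 0 < ℓ₁ ∧ (∀ q β, |p q β| ≤ P₀) ∧ PureSplitCl C_s C₁ A₀ β₁ ℓ₁ p

/-- (BF) RESTRICTED TO BOUNDED LEVEL CUTOFFS: `BackgroundFieldSU2` with the extra clause `kmax β R ≤ k₀` for some `k₀ : ℕ`. -/
def BackgroundFieldBoundedSU2 : Prop :=
  ∃ (𝔟 : BlockSize) (ε : ℝ → ℕ → ℝ) (kmax : ℝ → ℕ → ℕ) (k₀ : ℕ) (C_s C₁ A₀ P₀ β₁ ℓ₁ B_I : ℝ) (p : Fin 4 × Fin 4 → ℝ → ℝ),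
    (∀ β R, kmax β R ≤ k₀) ∧ 0 < C_s ∧ 0 < C₁ ∧ 0 ≤ A₀ ∧ 0 < ℓ₁ ∧ (∀ q β, |p q β| ≤ P₀) ∧
    SplitCl 𝔟 ε kmax C_s C₁ A₀ β₁ ℓ₁ p ∧ EMI 𝔟 ε kmax β₁ ℓ₁ B_I

/-- The flag-free split gives (split-cl) for EVERY tempering (`influenceAt ≥ 0`). [folklore] -/
theorem splitCl_of_pureSplitCl {C C₁ A₀ β₁ ℓ₁ : ℝ} {p : Fin 4 × Fin 4 → ℝ → ℝ} (h : PureSplitCl C C₁ A₀ β₁ ℓ₁ p)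
    (𝔟 : BlockSize) (ε : ℝ → ℕ → ℝ) (kmax : ℝ → ℕ → ℕ) : SplitCl 𝔟 ε kmax C C₁ A₀ β₁ ℓ₁ p :=
  fun β hβ R hR hRa q x hq η =>
    (h β hβ R hR hRa q x hq η).trans (le_add_of_nonneg_right (influenceAt_nonneg (N := 2) 𝔟 ε kmax β R q x η))

/-- (split-cl) at thresholds `> 2` IS the flag-free split (`influenceAt ≡ 0`). [folklore] -/
theorem pureSplitCl_of_splitCl_of_two_lt {𝔟 : BlockSize} {ε : ℝ → ℕ → ℝ} (hε : ∀ β k, 2 < ε β k) {kmax : ℝ → ℕ → ℕ}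
    {C C₁ A₀ β₁ ℓ₁ : ℝ} {p : Fin 4 × Fin 4 → ℝ → ℝ} (h : SplitCl 𝔟 ε kmax C C₁ A₀ β₁ ℓ₁ p) :
    PureSplitCl C C₁ A₀ β₁ ℓ₁ p := fun β hβ R hR hRa q x hq η => by
  have h0 := h β hβ R hR hRa q x hq η
  rwa [influenceAt_eq_zero_of_two_lt (N := 2) 𝔟 hε kmax β R q x η, add_zero] at h0

/-- (split-cl) at a bounded level cutoff gives the flag-free split with `A₀ ↦ A₀ + 1536·(k₀+1)` (sure bound on `influenceAt`).
[folklore] -/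
theorem pureSplitCl_of_splitCl_of_kmax_le {𝔟 : BlockSize} {ε : ℝ → ℕ → ℝ} {kmax : ℝ → ℕ → ℕ} {k₀ : ℕ}
    (hk : ∀ β R, kmax β R ≤ k₀) {C C₁ A₀ β₁ ℓ₁ : ℝ} {p : Fin 4 × Fin 4 → ℝ → ℝ} (h : SplitCl 𝔟 ε kmax C C₁ A₀ β₁ ℓ₁ p) :
    PureSplitCl C C₁ (A₀ + 1536 * ((k₀ : ℝ) + 1)) β₁ ℓ₁ p := fun β hβ R hR hRa q x hq η => by
  have h0 := h β hβ R hR hRa q x hq η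
  have h1 := influenceAt_le_of_kmax_le (N := 2) 𝔟 ε hk β R q x η
  linarith

/-- **(BF) FROM THE TEMPERING-FREE CLASSICAL SPLIT**: temper trivially (`𝔟 = 3`, `ε ≡ 3`, `kmax ≡ 0`), so that (split-cl) is the
flag-free split and (EM_I) holds with `B_I = 0`.  The large-field half of (BF) is OPTIONAL SLACK for its prover. [folklore] -/
theorem backgroundFieldSU2_of_pureSplitCl (h : PureSplitClSU2) : BackgroundFieldSU2 := by
  obtain ⟨C_s, C₁, A₀, P₀, β₁, ℓ₁, p, hCs, hC₁, hA₀, hℓ₁, hp, hsplit⟩ := h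
  have h3 : ∀ (_β : ℝ) (_k : ℕ), (2 : ℝ) < 3 := fun _ _ => by norm_num
  exact ⟨BlockSize.three, fun _ _ => 3, fun _ _ => 0, C_s, C₁, A₀, P₀, β₁, ℓ₁, 0, p, hCs, hC₁, hA₀, hℓ₁, hp,
    splitCl_of_pureSplitCl hsplit _ _ _, emi_of_two_lt BlockSize.three h3 _ β₁ ℓ₁⟩

/-- The trivially tempered (BF) has a bounded cutoff: the flag-free split gives `BackgroundFieldBoundedSU2`. [folklore] -/
theorem backgroundFieldBoundedSU2_of_pureSplitCl (h : PureSplitClSU2) : BackgroundFieldBoundedSU2 := by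
  obtain ⟨C_s, C₁, A₀, P₀, β₁, ℓ₁, p, hCs, hC₁, hA₀, hℓ₁, hp, hsplit⟩ := h
  have h3 : ∀ (_β : ℝ) (_k : ℕ), (2 : ℝ) < 3 := fun _ _ => by norm_num
  exact ⟨BlockSize.three, fun _ _ => 3, fun _ _ => 0, 0, C_s, C₁, A₀, P₀, β₁, ℓ₁, 0, p, fun _ _ => le_rfl, hCs, hC₁, hA₀, hℓ₁, hp,
    splitCl_of_pureSplitCl hsplit _ _ _, emi_of_two_lt BlockSize.three h3 _ β₁ ℓ₁⟩

/-- At a bounded cutoff (BF) gives back the flag-free split (`A₀ ↦ A₀ + 1536·(k₀+1)`; the (EM_I) conjunct is not used). [folklore] -/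
theorem pureSplitClSU2_of_backgroundFieldBounded (h : BackgroundFieldBoundedSU2) : PureSplitClSU2 := by
  obtain ⟨𝔟, ε, kmax, k₀, C_s, C₁, A₀, P₀, β₁, ℓ₁, B_I, p, hk, hCs, hC₁, hA₀, hℓ₁, hp, hsplit, -⟩ := h
  exact ⟨C_s, C₁, A₀ + 1536 * ((k₀ : ℝ) + 1), P₀, β₁, ℓ₁, p, hCs, hC₁, by positivity, hℓ₁, hp,
    pureSplitCl_of_splitCl_of_kmax_le hk hsplit⟩

/-- **AT BOUNDED LEVEL CUTOFFS (BF) IS THE TEMPERING-FREE CLASSICAL SPLIT**: `BackgroundFieldBoundedSU2 ↔ PureSplitClSU2` — the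
large-field half of the (β) architecture carries renormalisation-group content ONLY through a cutoff `kmax β R` that is unbounded along
the guard. [folklore] -/
theorem backgroundFieldBoundedSU2_iff : BackgroundFieldBoundedSU2 ↔ PureSplitClSU2 :=
  ⟨pureSplitClSU2_of_backgroundFieldBounded, backgroundFieldBoundedSU2_of_pureSplitCl⟩

/-- (BF) at bounded cutoff is a case of (BF). [folklore] -/
theorem backgroundFieldSU2_of_bounded (h : BackgroundFieldBoundedSU2) : BackgroundFieldSU2 :=
  backgroundFieldSU2_of_pureSplitCl (pureSplitClSU2_of_backgroundFieldBounded h)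

/-- **THE FLAG-FREE ROUTE TO THE REGISTERED STUB BODY**: the tempering-free classical split and (GD) «Gaussian domination» give
`ResponseMomentsOdd6SU2` (= the body of the registered v5(α) stub `stub_responseMomentsOdd6`, p536324/p540038) — the LEAD's glue
`responseMomentsOdd6SU2_of_backgroundField_and_gaussianDomination` (p548409) after `backgroundFieldSU2_of_pureSplitCl`. [folklore] -/
theorem responseMomentsOdd6SU2_of_pureSplitCl_and_gaussianDomination (hS : PureSplitClSU2) (hGD : GaussianDominationSU2) :
    ResponseMomentsDefs.ResponseMomentsOdd6SU2 :=
  responseMomentsOdd6SU2_of_backgroundField_and_gaussianDomination (backgroundFieldSU2_of_pureSplitCl hS) hGD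

end Pure

end Summit.QuantumFields.YangMills.Cruxes.UVSeamRec.ClassicalResponse

end
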